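import Literature.Topology.FourManifolds.BordismFourSumBounds
import Literature.Topology.FourManifolds.BordismProofs
import Literature.Topology.FourManifolds.CobordismAttachmentProofs
import Literature.Topology.FourManifolds.HomotopySpheresBP
import Literature.AlgebraicTopology.SingularHomology.ClosedBallSphereHomology
import HarnessLib

/-!
# Oriented bordism is transitive: attaching cobordisms, and the group law of `Ωₙ`
(proof file for `Literature.Topology.FourManifolds.isOrientedBordant_of_isEmpty_of_signature_eq_zero`)

Third sibling proof file (after `BordismFourNullBordism.lean`, `BordismFourSumBounds.lean`) of the
fact seat `provefact-Literature.Topology.FourManifolds.isOrientedBordant_of_isEmpty_of_signature_eq_zero`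
(R. Kirby, *The topology of 4-manifolds*, LNM 1374 (1989), Cor. IX.2: a closed oriented smooth
4-manifold of signature zero is an oriented boundary).  Every proof of that statement (Kirby's,
Ch. VIII–IX: surgery to a connected, then simply connected `M`, then `W = W₁ ∪ W₂ ∪ W₃ ∪ W₄`;
Thom's, Ch. IV) composes oriented bordisms.  This file proves that the tree's homological
oriented bordism (`IsOrientedBordant`, Hatcher §3.3 / Milnor–Stasheff §17 style) can be
composed, using the tree's attachment theorem `exists_cobordismAttachment_holds`
(Milnor, *Lectures on the h-cobordism theorem* (1965), Thm. 1.4, `CobordismAttachmentProofs.lean`)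
for the geometry and *only the exact sequence of the pair* (Hatcher 2002, Thm. 2.16) for the
homology: a datum `(W, w)` is needed only up to the existence of `w`, and
`w ∈ Hₙ₊₁(W, ∂W)` with prescribed `∂w = α` exists iff `α ↦ 0 ∈ Hₙ(W)` — so no Mayer–Vietoris
gluing of relative classes is required.

* §1 `IsCobordant.trans_succ` — **cobordism is transitive** (Milnor 1965, Thm. 1.4) for closed
  smooth manifolds of positive dimension: read `W₁` as a manifold with boundary datum
  `∂W₁ = M ⊔ N` (`IsSmoothEmbedding.sumElim` of `BordismProofs.lean`), attach `(M × [0,1]) ⊔ W₂` (the tree's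
  `cylinderCobordism` and `IsCobordant.sum` of `BordismProofs.lean`) along the identity of
  `M ⊔ N`; the result has boundary `M ⊔ P` (Thom's dictionary, `IsCobordant.of_sum_of_isEmpty`).
  (The tree's named fact `IsCobordant.trans` is stated for bare charted spaces in every
  dimension; this is its case of interest, not an exact discharge: in total dimension `1` the
  attachment structure cannot exist, see `exists_cobordismAttachment`.)
* §2 `IsOrientedBordant.trans_of_isEmpty` — **an oriented bordism attached to an oriented
  null-bordism is an oriented null-bordism**: `(M, μ) ∼ (N, ν)` and `(M, μ)` bounds ⟹ `(N, ν)`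
  bounds (the homological input `(inl)_*[M] = (inr)_*[N]` in `Hₙ(W)` is the tree's
  `Cobordism.map_inl_fundamentalClass_eq`, `BordismFourProofs.lean`).
* §3 `IsOrientedBordant.sum` — the disjoint union of oriented bordisms (addition in `Ωₙ`), on
  the witness `W ⊔ W'` of the tree's `Cobordism.exists_sum` (`IsSmoothEmbedding.sumMap`).
* §4 `IsOrientedBordant.trans`, `isOrientedBordant_equivalence` — **oriented bordism is
  transitive, hence an equivalence relation** (with `isOrientedBordant_refl`,
  `IsOrientedBordant.symm`), in positive dimension.
* §5 `isOrientedBordant_of_map_fundamentalClass_eq_zero`, `isOrientedBordant_isEmpty_iff` — the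
  **homological criterion**: `(M, μ)` is an oriented boundary iff `M` bounds some `W` in which
  `[M]_μ` dies; hence boundaries of compact manifolds with `Hₙ(W) = 0`, e.g. contractible ones,
  bound orientedly for EVERY orientation (`isOrientedBordant_of_isZero_singularHomology`,
  `isOrientedBordant_of_contractibleSpace`), and **spheres bound orientedly**
  (`isOrientedBordant_sphere`: `𝕊ⁿ = ∂𝔻ⁿ⁺¹`, the tree's `NullCobordism.closedBall`) — Kirby's
  Cor. IX.2 for `S⁴`.

Everything here is proved; no definitions, no named facts, no instances.  NOT here: the fact
itself (`Ω₄^SO ↪ ℤ`); the connected-sum cobordism `M₁ ⊔ M₂ ∼ M₁ # M₂`; dimension `0`.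

## References

* J. Milnor, *Lectures on the h-cobordism theorem*, Princeton 1965, §1, Thm. 1.4. [Milnor1965]
* R. Thom, Comment. Math. Helv. 28 (1954), Ch. IV §1 (p. 64). [ThomCMH1954]
* J. Milnor, J. Stasheff, *Characteristic classes* (1974), §17 p. 200, Lemma 17.1.
  [MilnorStasheffAMS76]
* A. Hatcher, *Algebraic Topology* (2002), Thm. 2.16, Prop. 2.8. [Hatcher2002]
* R. Kirby, *The topology of 4-manifolds*, LNM 1374 (1989), Ch. VIII Thm 1, Cor. IX.2. [Kirby1989]
-/

noncomputable section

open scoped Manifold ContDiff Topology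
open Set Function _root_.Topology

universe u

namespace Literature.Topology.FourManifolds

open Literature.AlgebraicTopology.SingularHomology

/-! ### §1 Transitivity of cobordism (Milnor 1965, Thm. 1.4) -/

section Trans

variable {n : ℕ} {M N P : Type u}
  [TopologicalSpace M] [ChartedSpace (EuclideanSpace ℝ (Fin (n + 1))) M]
  [TopologicalSpace N] [ChartedSpace (EuclideanSpace ℝ (Fin (n + 1))) N]
  [TopologicalSpace P] [ChartedSpace (EuclideanSpace ℝ (Fin (n + 1))) P]

/-- **Cobordism is transitive** (Milnor, *Lectures on the h-cobordism theorem* (1965), Thm. 1.4: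
the triads `(W₁; M, N)` and `(W₂; N, P)` glue to `(W₁ ∪_N W₂; M, P)`), for closed smooth
manifolds of positive dimension `n + 1`.  Proof from the tree's attachment theorem
`exists_cobordismAttachment_holds` (Milnor Thm. 1.4 for the triads `(W; ∅, ∂W)`, `(X; M', N')`):
read `W₁` as a manifold with boundary datum `∂W₁ = M ⊔ N` (`IsSmoothEmbedding.sumElim` of `BordismProofs.lean`), attach
the cobordism `X = (M × [0, 1]) ⊔ W₂` from `M ⊔ N` to `M ⊔ P` (`cylinderCobordism`,
`IsCobordant.sum`) along the identity of `M ⊔ N`; the result `V` has `∂V = M ⊔ P`, i.e. is a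
cobordism from `M ⊔ P` to `∅`, hence one from `M` to `P` (Thom's dictionary,
`IsCobordant.of_sum_of_isEmpty`).  This is the tree's named fact `IsCobordant.trans`
(`Cobordism.lean`) in positive dimension and for closed smooth ends (the fact is stated for bare
charted spaces and every dimension; in total dimension `1` the attachment structure cannot exist,
see `exists_cobordismAttachment`). [cite: Milnor1965, Thm 1.4 and §1] -/
theorem IsCobordant.trans_succ [T2Space M] [SecondCountableTopology M]
    [IsManifold (𝓡 (n + 1)) ∞ M] [CompactSpace M] [IsManifold (𝓡 (n + 1)) ∞ N] [CompactSpace N]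
    [IsManifold (𝓡 (n + 1)) ∞ P] [CompactSpace P]
    (h₁ : IsCobordant (n + 1) M N) (h₂ : IsCobordant (n + 1) N P) : IsCobordant (n + 1) M P := by
  obtain ⟨c₁⟩ := h₁
  -- `∂W₁ = M ⊔ N` as a boundary datum
  let b : BoundaryData (𝓡∂ (n + 2)) c₁.W (𝓡 (n + 1)) :=
    { carrier := M ⊕ N
      incl := Sum.elim c₁.inl c₁.inr
      isSmoothEmbedding := c₁.isSmoothEmbedding_inl.sumElim c₁.isSmoothEmbedding_inr
        c₁.disjoint_range
      range_incl := by rw [Set.Sum.elim_range, c₁.range_inl_union_range_inr] }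
  -- the cobordism `(M × [0, 1]) ⊔ W₂` from `M ⊔ N` to `M ⊔ P`
  obtain ⟨X⟩ := (isCobordant_self (n + 1) M).sum h₂
  -- attach it to `W₁` along the identity of `M ⊔ N`
  obtain ⟨V, _, _, _, _, _, ⟨A⟩⟩ := exists_cobordismAttachment_holds n c₁.W b (M ⊕ N) (M ⊕ P) X
    (Diffeomorph.refl (𝓡 (n + 1)) (M ⊕ N) ∞)
  haveI : CompactSpace V := A.compactSpace
  -- `∂V = M ⊔ P`: a cobordism from `M` to `P`
  exact ⟨{ W := V
           inl := (A.jX ∘ X.inr) ∘ Sum.inl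
           inr := (A.jX ∘ X.inr) ∘ Sum.inr
           isSmoothEmbedding_inl := isSmoothEmbedding_comp_inl A.isSmoothEmbedding_jX_comp_inr
           isSmoothEmbedding_inr := isSmoothEmbedding_comp_inr A.isSmoothEmbedding_jX_comp_inr
           disjoint_range := Set.disjoint_left.2 (by
             rintro _ ⟨x, rfl⟩ ⟨y, hy⟩
             exact Sum.inr_ne_inl (A.isSmoothEmbedding_jX_comp_inr.isEmbedding.injective hy))
           range_inl_union_range_inr := by
             rw [← A.range_jX_comp_inr]
             ext v
             constructor
             · rintro (⟨x, rfl⟩ | ⟨y, rfl⟩)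
               · exact ⟨Sum.inl x, rfl⟩
               · exact ⟨Sum.inr y, rfl⟩
             · rintro ⟨x | y, rfl⟩
               · exact Or.inl ⟨x, rfl⟩
               · exact Or.inr ⟨y, rfl⟩ }⟩

end Trans

/-! ### §2 Oriented null-bordisms are transitive along oriented bordisms (attachment) -/

section OrientedAttach

variable {n : ℕ} {M N E : Type u}
  [TopologicalSpace M] [ChartedSpace (EuclideanSpace ℝ (Fin (n + 1))) M]
  [TopologicalSpace N] [ChartedSpace (EuclideanSpace ℝ (Fin (n + 1))) N]
  [TopologicalSpace E] [ChartedSpace (EuclideanSpace ℝ (Fin (n + 1))) E]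

/-- **Attaching an oriented bordism to an oriented null-bordism** (Milnor 1965, Thm. 1.4, with
orientations; Thom 1954, Ch. IV §1: `Ωₙ` is well defined).  If `(M, μ) ∼ (N, ν)` (datum
`(X, w_X)`) and `(M, μ)` is an oriented boundary (datum `(W, w_W)`, second end empty), then
`(N, ν)` is an oriented boundary: attach `X` to `W` along `M` (`exists_cobordismAttachment_holds`);
the result `V` has `∂V = N`, and a class `w_V ∈ Hₙ₊₂(V, ∂V; ℤ)` with `∂w_V = (∂V ↩ N)_*[N]_ν`
exists by exactness of `Hₙ₊₂(V, ∂V) → Hₙ₊₁(∂V) → Hₙ₊₁(V)` (Hatcher Thm. 2.16), because in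
`Hₙ₊₁(V)`: `(j_X inr)_*[N] = (j_X inl)_*[M]` (the ends of `X` are homologous in `X`,
`Cobordism.map_inl_fundamentalClass_eq` of `BordismFourProofs.lean`) `= (j_W incl)_*[M]` (the seam)
`= 0` (`[M]` dies in `W`, same lemma with an empty second end).  Positive dimension `n + 1` (attachments do
not exist in total dimension `1`). [cite: Milnor1965, Thm 1.4 and §1] -/
theorem IsOrientedBordant.trans_of_isEmpty [IsManifold (𝓡 (n + 1)) ∞ M]
    [IsManifold (𝓡 (n + 1)) ∞ N] [IsEmpty E]
    {μ : HomologicalOrientation ℤ M (n + 1)} {ν : HomologicalOrientation ℤ N (n + 1)}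
    {ε : HomologicalOrientation ℤ E (n + 1)}
    (hMN : IsOrientedBordant (n + 1) μ ν) (hM : IsOrientedBordant (n + 1) μ ε) :
    IsOrientedBordant (n + 1) ν ε := by
  obtain ⟨X, wX, hwX⟩ := hMN
  obtain ⟨c₀, w₀, hw₀⟩ := hM
  -- `∂W₀ = M` as a boundary datum of the null-cobordism `W₀`
  let b : BoundaryData (𝓡∂ (n + 2)) c₀.W (𝓡 (n + 1)) :=
    { carrier := M
      incl := c₀.inl
      isSmoothEmbedding := c₀.isSmoothEmbedding_inl
      range_incl := c₀.range_inl_eq_boundary }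
  -- attach `X` to `W₀` along the identity of `M`
  obtain ⟨V, _, _, _, _, _, ⟨A⟩⟩ := exists_cobordismAttachment_holds n c₀.W b M N X
    (Diffeomorph.refl (𝓡 (n + 1)) M ∞)
  haveI : CompactSpace V := A.compactSpace
  -- `V` as a cobordism from `N` to the empty manifold
  let c : Cobordism (n + 1) N E :=
    { W := V
      inl := A.jX ∘ X.inr
      inr := fun e => isEmptyElim e
      isSmoothEmbedding_inl := A.isSmoothEmbedding_jX_comp_inr
      isSmoothEmbedding_inr :=
        ⟨⟨PUnit, inferInstance, inferInstance, fun e => isEmptyElim e⟩, .of_subsingleton _⟩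
      disjoint_range := by
        rw [range_eq_empty fun e : E => (isEmptyElim e : V)]
        exact disjoint_empty _
      range_inl_union_range_inr := by
        rw [range_eq_empty fun e : E => (isEmptyElim e : V), union_empty]
        exact A.range_jX_comp_inr }
  -- the three homological inputs, all in degree `n + 1`
  have hX := Cobordism.map_inl_fundamentalClass_eq X μ ν wX hwX
  have hW : singularHomology.map ℤ ℤ ⟨c₀.inl, c₀.continuous_inl⟩ (n + 1) μ.fundamentalClass = 0 := by
    have := Cobordism.map_inl_fundamentalClass_eq c₀ μ ε w₀ hw₀
    rwa [ε.fundamentalClass_eq_zero_of_isEmpty, map_zero] at this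
  have hseam : (⟨A.jW, A.continuous_jW⟩ : C(c₀.W, V)).comp ⟨c₀.inl, c₀.continuous_inl⟩ =
      (⟨A.jX, A.continuous_jX⟩ : C(X.W, V)).comp ⟨X.inl, X.continuous_inl⟩ :=
    ContinuousMap.ext fun z => A.jW_incl z
  -- `(∂V ↩ N)_*[N]` dies in `Hₙ₊₁(V)`
  set ιV : C(↥((𝓡∂ (n + 2)).boundary V), V) := ⟨Subtype.val, continuous_subtype_val⟩ with hιV
  have hfar : ιV.comp c.inlBoundary =
      (⟨A.jX, A.continuous_jX⟩ : C(X.W, V)).comp ⟨X.inr, X.continuous_inr⟩ :=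
    ContinuousMap.ext fun _ => rfl
  have hker : singularHomology.map ℤ ℤ ιV (n + 1)
      (singularHomology.map ℤ ℤ c.inlBoundary (n + 1) ν.fundamentalClass -
        singularHomology.map ℤ ℤ c.inrBoundary (n + 1) ε.fundamentalClass) = 0 := by
    rw [ε.fundamentalClass_eq_zero_of_isEmpty, map_zero, sub_zero, ← ModuleCat.comp_apply,
      ← singularHomology.map_comp, hfar, singularHomology.map_comp, ModuleCat.comp_apply, ← hX,
      ← ModuleCat.comp_apply, ← singularHomology.map_comp, ← hseam, singularHomology.map_comp,
      ModuleCat.comp_apply, hW, map_zero]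
  obtain ⟨w, hw⟩ := (CategoryTheory.ShortComplex.moduleCat_exact_iff _).1
    (relativeSingularHomology.exact_δ_map ℤ ℤ ((𝓡∂ (n + 2)).boundary V) (n + 1)) _ hker
  exact ⟨c, w, hw⟩

end OrientedAttach

/-! ### §3 The disjoint union of two oriented bordisms -/

section OrientedSum

open Literature.AlgebraicTopology.SingularHomology.SingularSimplex (sumInl sumInr)

variable {n : ℕ} {M N M' N' : Type u}
  [TopologicalSpace M] [ChartedSpace (EuclideanSpace ℝ (Fin n)) M]
  [TopologicalSpace N] [ChartedSpace (EuclideanSpace ℝ (Fin n)) N]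
  [TopologicalSpace M'] [ChartedSpace (EuclideanSpace ℝ (Fin n)) M']
  [TopologicalSpace N'] [ChartedSpace (EuclideanSpace ℝ (Fin n)) N']

/-- **The disjoint union of two oriented bordisms** (addition in `Ωₙ` is well defined; Thom 1954,
Ch. IV §1, p. 64; Milnor–Stasheff 1974, §17 p. 200): if `(M, μ) ∼ (N, ν)` and `(M', μ') ∼ (N', ν')`
then `(M ⊔ M', μ ⊔ μ') ∼ (N ⊔ N', ν ⊔ ν')` through `W ⊔ W'` (the tree's `Cobordism.exists_sum` /
`IsCobordant.sum`, `BordismProofs.lean`).  The relative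
class exists by exactness of `Hₙ₊₁(W ⊔ W', ∂) → Hₙ(∂) → Hₙ(W ⊔ W')` (Hatcher Thm. 2.16): the
class `(inl)_*[M ⊔ M'] − (inr)_*[N ⊔ N']` dies in `Hₙ(W ⊔ W')` because `[M ⊔ M'] = [M] + [M']`
(`fundamentalClass_sum`) and the ends of each of `W`, `W'` are homologous in it
(`Cobordism.map_inl_fundamentalClass_eq`). [cite: ThomCMH1954, Ch. IV §1 p. 64] -/
theorem IsOrientedBordant.sum [IsManifold (𝓡 n) ∞ M] [IsManifold (𝓡 n) ∞ N]
    [IsManifold (𝓡 n) ∞ M'] [IsManifold (𝓡 n) ∞ N'] [CompactSpace M] [T2Space M] [CompactSpace N]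
    [T2Space N] [CompactSpace M'] [T2Space M'] [CompactSpace N'] [T2Space N']
    {μ : HomologicalOrientation ℤ M n} {ν : HomologicalOrientation ℤ N n}
    {μ' : HomologicalOrientation ℤ M' n} {ν' : HomologicalOrientation ℤ N' n}
    {ξ : HomologicalOrientation ℤ (M ⊕ M') n} {ζ : HomologicalOrientation ℤ (N ⊕ N') n}
    (hξ₁ : ∀ x, ξ.localClass (Sum.inl x) =
      relativeSingularHomology.map ℤ ℤ (sumInl M M') (mapsTo_inl_compl_singleton x) n (μ.localClass x))
    (hξ₂ : ∀ y, ξ.localClass (Sum.inr y) =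
      relativeSingularHomology.map ℤ ℤ (sumInr M M') (mapsTo_inr_compl_singleton y) n (μ'.localClass y))
    (hζ₁ : ∀ x, ζ.localClass (Sum.inl x) =
      relativeSingularHomology.map ℤ ℤ (sumInl N N') (mapsTo_inl_compl_singleton x) n (ν.localClass x))
    (hζ₂ : ∀ y, ζ.localClass (Sum.inr y) =
      relativeSingularHomology.map ℤ ℤ (sumInr N N') (mapsTo_inr_compl_singleton y) n (ν'.localClass y))
    (h : IsOrientedBordant n μ ν) (h' : IsOrientedBordant n μ' ν') : IsOrientedBordant n ξ ζ := by
  obtain ⟨c, w, hw⟩ := h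
  obtain ⟨c', w', hw'⟩ := h'
  have e1 := Cobordism.map_inl_fundamentalClass_eq c μ ν w hw
  have e2 := Cobordism.map_inl_fundamentalClass_eq c' μ' ν' w' hw'
  -- the cobordism `W ⊔ W'` (the witness of the tree's `Cobordism.exists_sum`, `BordismProofs.lean`)
  let C : Cobordism n (M ⊕ M') (N ⊕ N') :=
    { W := c.W ⊕ c'.W
      inl := Sum.map c.inl c'.inl
      inr := Sum.map c.inr c'.inr
      isSmoothEmbedding_inl := c.isSmoothEmbedding_inl.sumMap c'.isSmoothEmbedding_inl
      isSmoothEmbedding_inr := c.isSmoothEmbedding_inr.sumMap c'.isSmoothEmbedding_inr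
      disjoint_range := c.disjoint_range_sumMap c'
      range_inl_union_range_inr := c.range_sumMap_union_range_sumMap c' }
  set ι : C(↥((𝓡∂ (n + 1)).boundary C.W), C.W) := ⟨Subtype.val, continuous_subtype_val⟩ with hι
  -- the four corners of the square of inclusions, as continuous maps
  have f1 : (ι.comp C.inlBoundary).comp (sumInl M M') =
      (sumInl c.W c'.W).comp ⟨c.inl, c.continuous_inl⟩ := ContinuousMap.ext fun _ => rfl
  have f2 : (ι.comp C.inlBoundary).comp (sumInr M M') =
      (sumInr c.W c'.W).comp ⟨c'.inl, c'.continuous_inl⟩ := ContinuousMap.ext fun _ => rfl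
  have f3 : (ι.comp C.inrBoundary).comp (sumInl N N') =
      (sumInl c.W c'.W).comp ⟨c.inr, c.continuous_inr⟩ := ContinuousMap.ext fun _ => rfl
  have f4 : (ι.comp C.inrBoundary).comp (sumInr N N') =
      (sumInr c.W c'.W).comp ⟨c'.inr, c'.continuous_inr⟩ := ContinuousMap.ext fun _ => rfl
  have t1 : singularHomology.map ℤ ℤ ι n (singularHomology.map ℤ ℤ C.inlBoundary n
      (singularHomology.map ℤ ℤ (sumInl M M') n μ.fundamentalClass)) =
      singularHomology.map ℤ ℤ (sumInl c.W c'.W) n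
        (singularHomology.map ℤ ℤ ⟨c.inl, c.continuous_inl⟩ n μ.fundamentalClass) := by
    rw [← ModuleCat.comp_apply, ← singularHomology.map_comp, ← ModuleCat.comp_apply,
      ← singularHomology.map_comp, f1, singularHomology.map_comp, ModuleCat.comp_apply]
  have t2 : singularHomology.map ℤ ℤ ι n (singularHomology.map ℤ ℤ C.inlBoundary n
      (singularHomology.map ℤ ℤ (sumInr M M') n μ'.fundamentalClass)) =
      singularHomology.map ℤ ℤ (sumInr c.W c'.W) n
        (singularHomology.map ℤ ℤ ⟨c'.inl, c'.continuous_inl⟩ n μ'.fundamentalClass) := by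
    rw [← ModuleCat.comp_apply, ← singularHomology.map_comp, ← ModuleCat.comp_apply,
      ← singularHomology.map_comp, f2, singularHomology.map_comp, ModuleCat.comp_apply]
  have t3 : singularHomology.map ℤ ℤ ι n (singularHomology.map ℤ ℤ C.inrBoundary n
      (singularHomology.map ℤ ℤ (sumInl N N') n ν.fundamentalClass)) =
      singularHomology.map ℤ ℤ (sumInl c.W c'.W) n
        (singularHomology.map ℤ ℤ ⟨c.inr, c.continuous_inr⟩ n ν.fundamentalClass) := by
    rw [← ModuleCat.comp_apply, ← singularHomology.map_comp, ← ModuleCat.comp_apply,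
      ← singularHomology.map_comp, f3, singularHomology.map_comp, ModuleCat.comp_apply]
  have t4 : singularHomology.map ℤ ℤ ι n (singularHomology.map ℤ ℤ C.inrBoundary n
      (singularHomology.map ℤ ℤ (sumInr N N') n ν'.fundamentalClass)) =
      singularHomology.map ℤ ℤ (sumInr c.W c'.W) n
        (singularHomology.map ℤ ℤ ⟨c'.inr, c'.continuous_inr⟩ n ν'.fundamentalClass) := by
    rw [← ModuleCat.comp_apply, ← singularHomology.map_comp, ← ModuleCat.comp_apply,
      ← singularHomology.map_comp, f4, singularHomology.map_comp, ModuleCat.comp_apply]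
  have hker : singularHomology.map ℤ ℤ ι n
      (singularHomology.map ℤ ℤ C.inlBoundary n ξ.fundamentalClass -
        singularHomology.map ℤ ℤ C.inrBoundary n ζ.fundamentalClass) = 0 := by
    rw [HomologicalOrientation.fundamentalClass_sum ℤ μ μ' ξ hξ₁ hξ₂,
      HomologicalOrientation.fundamentalClass_sum ℤ ν ν' ζ hζ₁ hζ₂, map_add, map_add, map_sub,
      map_add, map_add, t1, t2, t3, t4, e1, e2, sub_self]
  obtain ⟨u, hu⟩ := (CategoryTheory.ShortComplex.moduleCat_exact_iff _).1
    (relativeSingularHomology.exact_δ_map ℤ ℤ ((𝓡∂ (n + 1)).boundary C.W) n) _ hker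
  exact ⟨C, u, hu⟩

end OrientedSum

/-! ### §4 Oriented bordism is transitive -/

section OrientedTrans

variable {n : ℕ} {M N P : Type u}
  [TopologicalSpace M] [ChartedSpace (EuclideanSpace ℝ (Fin (n + 1))) M]
  [TopologicalSpace N] [ChartedSpace (EuclideanSpace ℝ (Fin (n + 1))) N]
  [TopologicalSpace P] [ChartedSpace (EuclideanSpace ℝ (Fin (n + 1))) P]

/-- **Oriented bordism is transitive** (Thom 1954, Ch. IV §1, p. 64: cobordism "est une relation
d'équivalence"; Milnor–Stasheff 1974, Lemma 17.1; geometrically Milnor 1965, Thm. 1.4), for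
closed smooth `ℤ`-oriented manifolds of positive dimension `n + 1`, in the tree's homological
sense `IsOrientedBordant`.  Proof through Thom's dictionary: `(M ⊔ N, μ ⊔ −ν)` bounds
(`IsOrientedBordant.sum_of_isEmpty`); `(M × [0,1]) ⊔ W₂⁻` is an oriented bordism from
`(M ⊔ N, μ ⊔ −ν)` to `(M ⊔ P, μ ⊔ −π)` (`isOrientedBordant_refl`, `IsOrientedBordant.neg`,
`IsOrientedBordant.sum`); attaching it gives a null-bordism of `(M ⊔ P, μ ⊔ −π)`
(`IsOrientedBordant.trans_of_isEmpty`), i.e. `(M, μ) ∼ (P, π)`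
(`IsOrientedBordant.of_sum_of_isEmpty`). [cite: ThomCMH1954, Ch. IV §1 p. 64] -/
theorem IsOrientedBordant.trans [T2Space M] [SecondCountableTopology M]
    [IsManifold (𝓡 (n + 1)) ∞ M] [CompactSpace M] [T2Space N] [IsManifold (𝓡 (n + 1)) ∞ N]
    [CompactSpace N] [T2Space P] [IsManifold (𝓡 (n + 1)) ∞ P] [CompactSpace P]
    {μ : HomologicalOrientation ℤ M (n + 1)} {ν : HomologicalOrientation ℤ N (n + 1)}
    {π : HomologicalOrientation ℤ P (n + 1)}
    (h₁ : IsOrientedBordant (n + 1) μ ν) (h₂ : IsOrientedBordant (n + 1) ν π) :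
    IsOrientedBordant (n + 1) μ π := by
  -- the empty end
  letI : ChartedSpace (EuclideanSpace ℝ (Fin (n + 1))) PEmpty.{u + 1} := ChartedSpace.empty _ _
  let ε : HomologicalOrientation ℤ PEmpty.{u + 1} (n + 1) :=
    { localClass := fun e => isEmptyElim e
      isGenerator := fun e => isEmptyElim e
      locallyConsistent := fun e => isEmptyElim e }
  -- `(M ⊔ N, μ ⊔ −ν)` bounds
  obtain ⟨ξ, hξ₁, hξ₂⟩ := HomologicalOrientation.exists_sum ℤ μ (-ν)
  have hW : IsOrientedBordant (n + 1) ξ ε := h₁.sum_of_isEmpty hξ₁ hξ₂ ε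
  -- `(M × [0, 1]) ⊔ W₂⁻ : (M ⊔ N, μ ⊔ −ν) ∼ (M ⊔ P, μ ⊔ −π)`
  obtain ⟨ξ', hξ'₁, hξ'₂⟩ := HomologicalOrientation.exists_sum ℤ μ (-π)
  have h₂' : IsOrientedBordant (n + 1) (-ν) (-π) :=
    h₂.neg (HomologicalOrientation.fundamentalClass_neg_holds (R := ℤ) (X := N) (n + 1))
      (HomologicalOrientation.fundamentalClass_neg_holds (R := ℤ) (X := P) (n + 1))
  have hX : IsOrientedBordant (n + 1) ξ ξ' :=
    (isOrientedBordant_refl μ).sum hξ₁ hξ₂ hξ'₁ hξ'₂ h₂'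
  -- attach, and read the result as a bordism from `M` to `P`
  exact IsOrientedBordant.of_sum_of_isEmpty hξ'₁ hξ'₂ (hX.trans_of_isEmpty hW)

/-- **Oriented bordism is an equivalence relation** on closed smooth `ℤ`-oriented manifolds of
positive dimension, in the tree's homological sense (`isOrientedBordant_refl`,
`IsOrientedBordant.symm`, `IsOrientedBordant.trans`): Thom 1954, Ch. IV §1. Stated for one
closed smooth manifold `M` and all its `ℤ`-orientations. [cite: ThomCMH1954, Ch. IV §1 p. 64] -/
theorem isOrientedBordant_equivalence [T2Space M] [SecondCountableTopology M]
    [IsManifold (𝓡 (n + 1)) ∞ M] [CompactSpace M] :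
    Equivalence fun μ ν : HomologicalOrientation ℤ M (n + 1) => IsOrientedBordant (n + 1) μ ν :=
  ⟨isOrientedBordant_refl, IsOrientedBordant.symm, IsOrientedBordant.trans⟩

end OrientedTrans

/-! ### §5 Examples: boundaries of acyclic manifolds, spheres -/

section Examples

variable {n : ℕ} {M E : Type u}
  [TopologicalSpace M] [ChartedSpace (EuclideanSpace ℝ (Fin n)) M]
  [TopologicalSpace E] [ChartedSpace (EuclideanSpace ℝ (Fin n)) E]

/-- **Homological criterion for oriented null-bordism.**  If `M = ∂W` (a cobordism from `M` to an
empty manifold) and the fundamental class `[M]_μ` dies in `Hₙ(W; ℤ)`, then `(M, μ)` is an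
oriented boundary: the class `w ∈ Hₙ₊₁(W, ∂W)` with `∂w = (∂W ↩ M)_*[M]_μ` exists by exactness of
the sequence of the pair (Hatcher 2002, Thm. 2.16).  (Conversely `(inl)_*[M]_μ = 0` for every
oriented null-bordism, `Cobordism.map_inl_fundamentalClass_eq`.) [cite: Hatcher2002, Thm 2.16] -/
theorem isOrientedBordant_of_map_fundamentalClass_eq_zero [IsEmpty E] (c : Cobordism n M E)
    (μ : HomologicalOrientation ℤ M n) (ε : HomologicalOrientation ℤ E n)
    (h : singularHomology.map ℤ ℤ ⟨c.inl, c.continuous_inl⟩ n μ.fundamentalClass = 0) :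
    IsOrientedBordant n μ ε := by
  set ι : C(↥((𝓡∂ (n + 1)).boundary c.W), c.W) := ⟨Subtype.val, continuous_subtype_val⟩ with hι
  have h0 : ι.comp c.inlBoundary = ⟨c.inl, c.continuous_inl⟩ := ContinuousMap.ext fun _ => rfl
  have hker : singularHomology.map ℤ ℤ ι n
      (singularHomology.map ℤ ℤ c.inlBoundary n μ.fundamentalClass -
        singularHomology.map ℤ ℤ c.inrBoundary n ε.fundamentalClass) = 0 := by
    rw [ε.fundamentalClass_eq_zero_of_isEmpty, map_zero, sub_zero, ← ModuleCat.comp_apply,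
      ← singularHomology.map_comp, h0, h]
  obtain ⟨w, hw⟩ := (CategoryTheory.ShortComplex.moduleCat_exact_iff _).1
    (relativeSingularHomology.exact_δ_map ℤ ℤ ((𝓡∂ (n + 1)).boundary c.W) n) _ hker
  exact ⟨c, w, hw⟩

/-- **`(M, μ)` is an oriented boundary iff `M` bounds some `W` in which `[M]_μ` dies**
(`Hₙ(M) → Hₙ(W)`), for closed smooth `M`. [cite: Hatcher2002, Thm 2.16] -/
theorem isOrientedBordant_isEmpty_iff [IsEmpty E] (μ : HomologicalOrientation ℤ M n)
    (ε : HomologicalOrientation ℤ E n) :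
    IsOrientedBordant n μ ε ↔ ∃ c : Cobordism n M E,
      singularHomology.map ℤ ℤ ⟨c.inl, c.continuous_inl⟩ n μ.fundamentalClass = 0 := by
  constructor
  · rintro ⟨c, w, hw⟩
    refine ⟨c, ?_⟩
    have := Cobordism.map_inl_fundamentalClass_eq c μ ε w hw
    rwa [ε.fundamentalClass_eq_zero_of_isEmpty, map_zero] at this
  · rintro ⟨c, hc⟩
    exact isOrientedBordant_of_map_fundamentalClass_eq_zero c μ ε hc

/-- **The boundary of a compact manifold with `Hₙ(W; ℤ) = 0` — e.g. a contractible one — bounds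
orientedly for every orientation**: `(∂W, μ)` is an oriented boundary for all `μ`.  In particular Kirby's Cor. IX.2 holds for such `M`.
[cite: Hatcher2002, Thm 2.16] -/
theorem isOrientedBordant_of_isZero_singularHomology [IsEmpty E] (c : Cobordism n M E)
    (hW : CategoryTheory.Limits.IsZero (singularHomology ℤ ℤ c.W n))
    (μ : HomologicalOrientation ℤ M n) (ε : HomologicalOrientation ℤ E n) :
    IsOrientedBordant n μ ε :=
  haveI := ModuleCat.subsingleton_of_isZero hW
  isOrientedBordant_of_map_fundamentalClass_eq_zero c μ ε (Subsingleton.elim _ _)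

/-- **The boundary of a compact contractible manifold bounds orientedly for every orientation**
(`Hₙ(W) = 0` for `n ≥ 1`, Hatcher Prop. 2.8). [cite: Hatcher2002, Prop. 2.8] -/
theorem isOrientedBordant_of_contractibleSpace (hn : n ≠ 0) [IsEmpty E] (c : Cobordism n M E)
    [ContractibleSpace c.W] (μ : HomologicalOrientation ℤ M n) (ε : HomologicalOrientation ℤ E n) :
    IsOrientedBordant n μ ε :=
  isOrientedBordant_of_isZero_singularHomology c
    (isZero_singularHomology_of_contractibleSpace ℤ ℤ hn) μ ε

/-- **Spheres bound orientedly**: for `n ≥ 1` and every `ℤ`-orientation `μ` of the standard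
sphere `𝕊ⁿ ⊆ ℝⁿ⁺¹` (Mathlib's charted sphere), `(𝕊ⁿ, μ)` is an oriented boundary — of the closed
ball `𝔻ⁿ⁺¹` (the tree's null-cobordism `NullCobordism.closedBall`, `HomotopySpheresBP.lean`),
which is contractible.  For `n = 4`: Kirby's Cor. IX.2 for `S⁴` (`σ(S⁴) = 0`).
[cite: Kirby1989, Cor. IX.2] -/
theorem isOrientedBordant_sphere (hn : n ≠ 0) {E : Type} [TopologicalSpace E]
    [ChartedSpace (EuclideanSpace ℝ (Fin n)) E] [IsEmpty E]
    (μ : HomologicalOrientation ℤ ↥(Metric.sphere (0 : EuclideanSpace ℝ (Fin (n + 1))) 1) n)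
    (ε : HomologicalOrientation ℤ E n) : IsOrientedBordant n μ ε :=
  haveI : ContractibleSpace ((NullCobordism.closedBall n).toCobordism E).W :=
    contractibleSpace_closedBall (n + 1)
  isOrientedBordant_of_contractibleSpace hn ((NullCobordism.closedBall n).toCobordism E) μ ε

end Examples

end Literature.Topology.FourManifolds

end
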